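import Summits.FinalStateConjecture.FinalStateConjecture.Theorems.ZeroEnergyKerrOrBombErgoregionBomb
import Summits.FinalStateConjecture.FinalStateConjecture.Theorems.ZeroEnergyRigidity.Negative.KillingNonvanishingOfGH

/-!
# `ZeroEnergyRigidity` (crux `stmt-FinalStateConjecture-10690`): the typed crux is `CoreRigidityGH`,
# unconditionally — hypotheses h5 AND h6 are theorems under h4

Load-bearing certificate for the crux `ZeroEnergyRigidity` of route `ZeroEnergyKerrOrBomb`
(line lead gen 2, `--supports stmt-FinalStateConjecture-10690`).  The crux quantifies over
presentations `𝓑 : StationaryAFBlackHole` with hypotheses h1 vacuum, h2 `𝓔⁺` connected, h3 `𝓔⁺` a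
non-degenerate Killing horizon (GLOBAL Killing field), h4 the carrier globally hyperbolic,
h5 `T ≠ 0` on the d.o.c., h6 "no zero-energy null geodesic ray `γ|[0,∞)` stays in a compact
`K ⊆ doc`".

* h5 follows from h4 (`killing_ne_zero_of_mem_doc_of_isGloballyHyperbolic`, landed in
  `KillingNonvanishingOfGH.lean`: Chruściel–Costa 2008, Cor. 3.8 + chronology).
* **h6 follows from h4** (`noImprisonedZeroEnergyRay_of_isGloballyHyperbolic`, this file), with NO
  hypothesis schema left: globally hyperbolic ⇒ strongly causal (Bernal–Sánchez 2007, Thm. 3.2,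
  tree theorem `LorentzianMetric.bernalSanchez_isStronglyCausal_of_isGloballyHyperbolic_holds`) ⇒ no
  future-endless causal curve is imprisoned in a compact set (O'Neill 1983, Ch. 14, Lemma 13, tree
  theorem `LorentzianMetric.IsStronglyCausal.exists_forall_notMem_of_isCompact_holds`), while an
  affinely parametrised geodesic ray with null, hence non-zero, velocity is future endless (O'Neill
  1983, Ch. 5, Lemma 8, tree theorem `PseudoRiemannianMetric.isFutureEndless_Ici_of_isGeodesicOn`);
  the three are composed for both time orientations of the ray by the landed
  `ErgoregionBomb.Negative.trapping_clause_contradictory` (the lemma that closed the sibling crux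
  `ErgoregionBomb`, stmt-FinalStateConjecture-10691, vacuously).  The zero-energy clause
  `g(T, γ') = 0` and `K ⊆ doc` are not used.

Consequence (pure logic, `zeroEnergyRigidity_iff_core`): **the crux AS TYPED is equivalent to the
statement with h5 and h6 deleted** — `CoreRigidityGH`: every vacuum presentation with connected
non-degenerate (Hawking-rigid, global Killing generator) future event horizon and globally
hyperbolic carrier has d.o.c. isometric to a sub-extremal Kerr exterior.  No zero-energy /
trapping input survives in the typed statement; the informal item ("Γ₀ = ∅ ⇒ Kerr", the
Alexakis–Ionescu–Klainerman conjecture) is therefore NOT what the formal item says.  The earlier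
Disproof-file version of this equivalence (`Cruxes/ZeroEnergyRigidity/Disproof.lean`, F2/F8) was
modulo a non-imprisonment hypothesis schema; here it is unconditional.

References: A. N. Bernal, M. Sánchez, Class. Quantum Grav. 24 (2007) 745, Thm. 3.2; B. O'Neill,
*Semi-Riemannian Geometry* (1983), Ch. 5 Lemma 8, Ch. 14 Lemma 13; S. W. Hawking, G. F. R. Ellis
(1973), Prop. 6.4.7; P. T. Chruściel, J. L. Costa, Astérisque 321 (2008), Cor. 3.8.
-/

noncomputable section

set_option linter.dupNamespace false

namespace Summit.FinalStateConjecture.FinalStateConjecture.Theorems.ZeroEnergyRigidity.Negative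

open Literature.Geometry.Lorentzian
open scoped Manifold ContDiff
open Summit.FinalStateConjecture.FinalStateConjecture.Theses.ZeroEnergyKerrOrBomb (ZeroEnergyRigidity)

/-- **h4 ⇒ h6, for every presentation.**  On a globally hyperbolic carrier every affinely
parametrised geodesic ray `γ|[0,∞)` with null velocity leaves every compact set `K` (whether or not
`K ⊆ doc`, whether or not `g(T, γ') = 0`): Bernal–Sánchez strong causality + O'Neill's
non-imprisonment lemma + endlessness of geodesic rays, composed by
`ErgoregionBomb.Negative.trapping_clause_contradictory` with the tree's `_holds` theorems — no
hypothesis schema remains.  This is hypothesis h6 of the typed crux `ZeroEnergyRigidity`, verbatim,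
derived from h4. [cite: ONeillSemiRiemannian1983, Ch. 14, Lemma 13 (p. 407)] -/
theorem noImprisonedZeroEnergyRay_of_isGloballyHyperbolic (𝓑 : StationaryAFBlackHole.{0})
    [𝓑.metric.HasLeviCivita] (h4 : 𝓑.metric.IsGloballyHyperbolic 𝓑.timeOrientation) :
    ∀ γ : ℝ → 𝓑.carrier, IsGeodesicOn 𝓑.metric.leviCivita γ (Set.Ici 0) →
      (∀ s : ℝ, 0 ≤ s → 𝓑.metric.IsNull (velocity (𝓡 4) γ s) ∧
        𝓑.metric.val (γ s) (𝓑.killing (γ s)) (velocity (𝓡 4) γ s) = 0) →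
      ∀ K : Set 𝓑.carrier, IsCompact K → K ⊆ 𝓑.doc → ∃ s : ℝ, 0 ≤ s ∧ γ s ∉ K := by
  intro γ hg hz K hK _
  by_contra h
  push Not at h
  exact ErgoregionBomb.Negative.trapping_clause_contradictory 𝓑
    (Theorems.stub_bernalSanchez 𝓑) (Theorems.stub_nonImprisonment 𝓑)
    (fun γ' hg' hv' ↦ PseudoRiemannianMetric.isFutureEndless_Ici_of_isGeodesicOn
      𝓑.metric.toPseudoRiemannianMetric (WithTop.coe_le_coe.mpr le_top) hg' hv')
    h4 hg (fun s hs ↦ (hz s hs).1) hK h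

/-- **`ZeroEnergyRigidity` AS TYPED is `CoreRigidityGH`** — the served statement of
`stmt-FinalStateConjecture-10690` is equivalent to itself with BOTH h5 (`∀ p ∈ 𝓑.doc, 𝓑.killing p ≠ 0`)
and h6 (no compactly imprisoned zero-energy null ray) deleted; the right-hand side is the served
body verbatim minus those two binders.  Unconditional: pure logic over
`killing_ne_zero_of_mem_doc_of_isGloballyHyperbolic` (h4 ⇒ h5) and
`noImprisonedZeroEnergyRay_of_isGloballyHyperbolic` (h4 ⇒ h6).  In words: as typed, the crux is
smooth stationary vacuum black-hole uniqueness for globally hyperbolic presentations with a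
connected, Hawking-rigid (global Killing generator), non-degenerate horizon — it carries no
zero-energy non-trapping hypothesis at all. [folklore] -/
theorem zeroEnergyRigidity_iff_core :
    ZeroEnergyRigidity ↔
      ∀ (𝓑 : StationaryAFBlackHole.{0}) [𝓑.metric.HasLeviCivita] [Kerr.Facts],
        𝓑.metric.toPseudoRiemannianMetric.IsRicciFlat → IsConnected 𝓑.horizon →
        𝓑.toSpacetime.IsNonDegenerateHorizon 𝓑.Mext →
        𝓑.metric.IsGloballyHyperbolic 𝓑.timeOrientation →
        ∃ (M a : ℝ), Kerr.IsSubextremal M a ∧ ∃ Ψ : Kerr.exterior M a → 𝓑.carrier,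
          Function.Injective Ψ ∧ Set.range Ψ = 𝓑.doc ∧
            PseudoRiemannianMetric.IsIsometricImmersion
              (Kerr.smoothMetric M a (Kerr.rPlus M a)).toPseudoRiemannianMetric
              𝓑.metric.toPseudoRiemannianMetric Ψ :=
  ⟨fun h 𝓑 _ _ h1 h2 h3 h4 ↦
      h 𝓑 h1 h2 h3 h4 (fun _ hp ↦ killing_ne_zero_of_mem_doc_of_isGloballyHyperbolic 𝓑 h4 hp)
        (noImprisonedZeroEnergyRay_of_isGloballyHyperbolic 𝓑 h4),
    fun h 𝓑 _ _ h1 h2 h3 h4 _ _ ↦ h 𝓑 h1 h2 h3 h4⟩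

end Summit.FinalStateConjecture.FinalStateConjecture.Theorems.ZeroEnergyRigidity.Negative

end
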